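import Mathlib
import Literature.Analysis.FluidPDE.Tao2016AveragedNS.ShiftSetCascadeFlows
import Literature.Analysis.FluidPDE.Tao2016AveragedNS.ShiftSetCascadeFlux
import Summits.NavierStokesRegularity.NavierStokesRegularity.Theorems.TaoLadderRungTwoFlatCertificateGlueScalarsE3On
import Summits.NavierStokesRegularity.NavierStokesRegularity.Theorems.TaoLadderRungTwoFlatCertificateGlueCertificateFinalLOn
import HarnessLib

/-!
# Certificate glue on a shift set `𝕊`, XXXVII-b: THE FINAL ASSEMBLY SPECIALISED TO THE E3 CONSTANTS — glue XXXVI-c `stub_rung_quarter_of_certificateL`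
  with EVERY real-number hypothesis discharged by glue XXXVII-a (`Kb = 36`, `Ka = 12`, `r = 10⁻⁶`, `ρ = ½`, `θ₀ = 3/10`, `θ = ½`, `c₀ = 9/10`,
  `c = 91/100`, `σ = ¼`, `Cw = 1`, `b = ½`, `Cb = 7`, `γ = ½`, `ν = nuE3`, `ϑ = varthetaE3`, `X₀ = (1, 2)`, weights `pgaussW 1`, `Zb = ZbE3`,
  `Zf = ZfE3`, `Eb = EbE3`, `Et = EtE3`, `Zx = ZxE3`, `Mmax = 404`) (helper for item stmt-NavierStokesRegularity-22987 `FlatGapCertificatesV2` (crux K_A♭ of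
  route TaoLadderRungTwoFlat); cell harvest/h2-tao-ladder, p1 g17; theory-1 E3 v0 / INSTANCE-MANIFEST v1; referee P158 / P163 / P165)

WHAT REMAINS in `stub_rung_quarter_of_certificateE3`: three RATIONAL facts about the a-priori table `Mq` (`Mq k ≤ 404` on the window, `Mq (−36) ≤ 777`,
`Mq 12 ≤ 401/10²⁷`) and the certificate's BOOLEANS (per-branch `CoefBoxOK` / `checkGlobalG`, `checkStepG` per step with `Eb = EbE3`, `Et = EtE3`,
`checkTransit`, `checkSection`, `checkReadoutL` with `Zx = ZxE3`, `checkSecBelow/Above`, clocks `0 < Σh(j₁)`, `Σh(j₂+1) ≤ 9/10`, `91/100 ≤ Σh(N)`,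
`checkIdFrame`, `checkNonneg`, `checkRefBox` per box, `checkDatumBox` for `x0E3`) — nothing over `ℝ`.

HONEST FRAMING: Tao-type MODEL lattice `T♭(½)` on `S♭` at `ε₀ = ¼`; soundness of the certificate FORMAT with constants plugged in — NO certificate instance
exists in the tree, nothing is certified here, no stub is closed by this file, nothing here is a statement about the Navier–Stokes equations.
-/

noncomputable section

-- the sub-problem namespace repeats the summit name by design (D-0017)
set_option linter.dupNamespace false

namespace Summit.NavierStokesRegularity.NavierStokesRegularity.Theorems

open Set Finset Literature.Analysis.FluidPDE Literature.Analysis.FluidPDE.TaoCascade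
open Summit.NavierStokesRegularity.NavierStokesRegularity.Theorems.TaylorModelCert

namespace CertificateGlueOn

/-- **THE REGISTERED STUB `stub_rung_quarter` FROM A CHECKED CERTIFICATE — E3 CONSTANTS, BOOLEANS ONLY**: glue XXXVI-c `stub_rung_quarter_of_certificateL`
with every real-number hypothesis discharged for theory-1's E3 v0 constants (module docstring). Remaining inputs: the a-priori table `Mq` with three rational
facts, and the certificate's Booleans (per-branch gauges, READOUT-L, box-family core).
[cite: Tao2016AveragedNS, §6.3–6.4 Props. 6.4–6.5 (statement shape of a renormalisation certificate); route TaoLadderRungTwoFlat, crux K_A♭, stub_rung_quarter, certificate format E3] -/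
theorem stub_rung_quarter_of_certificateE3
    -- the a-priori box (glue gauge) and its three rational facts
    {Mq : ℤ → ℚ} (hMmax : ∀ k, -36 ≤ k → k ≤ 12 → Mq k ≤ 404) (hM36 : Mq (-36) ≤ 777) (hM12 : Mq 12 ≤ 401 / 1000000000000000000000000000)
    -- THE CERTIFICATE: per-branch gauges and tables, branch chains, section records, READOUT-L data, the box family
    {ι : Type*} {ωq : ι → Fin 2 → ℤ → ℚ} (hω : ∀ bb i k, 0 < ωq bb i k)
    {cB : ι → Fin 2 → ℤ → Fin 2 → Fin 2 → ℤ × ℤ × ℤ → IntervalD}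
    (hcoef : ∀ bb, CoefBoxOK shiftsFlat (((1 / 4 : ℚ)) : ℝ) (fun i₁ i₂ i μ => ((mirrorTableQ (1 / 2) (1 / 2) i₁ i₂ i μ : ℚ) : ℝ)) 36 12
      (fun i k => (ωq bb i k : ℝ)) (cB bb))
    {prec p : ι → ℕ} {kexp nexp : ℕ} {Sp Sm : ι → IntervalD} {bD : ι → Dyad} {qz : ι → Array ℤ} {lev : ι → ℚ}
    {rec : ι → ℕ → VRec} {N j₁ j₂ : ι → ℕ} {sr : ι → ℕ → SecRec} {ell : ι → ℕ → Array Dyad}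
    {L : ℕ} {Cs : Fin L → ℚ} {cen chw : Fin L → Array Dyad} {start : Fin L → ι} {tgt : ι → ℕ → Fin L} {l₀ : Fin L}
    (hg : ∀ bb, checkGlobalG 2 36 12 (prec bb) shiftsFlat (cB bb) (1 / 4) (Sp bb) (Sm bb) (bD bb) = true)
    (hs : ∀ bb j, j < N bb →
      checkStepG 2 36 12 (prec bb) (p bb) kexp nexp shiftsFlat (cB bb) (mirrorTableQ (1 / 2) (1 / 2)) (ωq bb) (Sp bb) (Sm bb) (bD bb) EbE3 EtE3 (rec bb) j = true)
    (htr : ∀ bb j, j < N bb → checkTransit 2 36 12 (ωq bb) Mq (rec bb j).lo (rec bb j).hi = true)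
    (hcN : ∀ bb, (91 / 100 : ℚ) ≤ sumHV (rec bb) (N bb))
    (hj : ∀ bb, j₁ bb ≤ j₂ bb) (hjN : ∀ bb, j₂ bb < N bb)
    (hsec : ∀ bb j, j₁ bb ≤ j → j ≤ j₂ bb →
      checkSection 2 36 12 (prec bb) shiftsFlat (cB bb) (qz bb) (rec bb j).lo (rec bb j).hi (rec bb j).δ (sr bb j) = true)
    (hread : ∀ bb j, j₁ bb ≤ j → j ≤ j₂ bb →
      checkReadoutL 2 36 12 (ωq bb) 0 (1 / 4) (1 / 4) (1 / 2) (1 / 1000000) ZxE3 EtE3 3 10 (pgaussW 1) (Cs (tgt bb j)) (ell bb j) (cen (tgt bb j)) (chw (tgt bb j))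
        (xsArr (2 * winLen 36 12) (qz bb) (sr bb j) (rec bb j).x (lev bb)) (csArr (2 * winLen 36 12) (qz bb) (sr bb j) (rec bb j).C) (rec bb j).r
        (esArr (2 * winLen 36 12) (qz bb) (sr bb j) (rec bb j).E (rec bb j).h) = true)
    (hbefore : ∀ bb, checkSecBelow (2 * winLen 36 12) (qz bb) (rec bb (j₁ bb)) (lev bb) = true)
    (hafter : ∀ bb, checkSecAbove (2 * winLen 36 12) (qz bb) (rec bb (j₂ bb + 1)) (lev bb) = true)
    (hpos : ∀ bb, 0 < sumHV (rec bb) (j₁ bb)) (hc₀N : ∀ bb, sumHV (rec bb) (j₂ bb + 1) ≤ (9 / 10 : ℚ))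
    (hid : ∀ bb, checkIdFrame (2 * winLen 36 12) (rec bb 0).C = true) (hE : ∀ bb, checkNonneg (2 * winLen 36 12) (rec bb 0).E = true)
    (hrefs : ∀ l, checkRefBox 36 12 (ωq (start l)) (pgaussW 1) Mq (1 / 1000000) (Cs l) (cen l) (chw l) (rec (start l) 0).x (rec (start l) 0).r = true)
    (hdat : checkDatumBox 36 12 x0E3 (Cs l₀) (cen l₀) (chw l₀) = true) :
    ∃ (σ : ℝ) (X₀ : Fin 2 → ℝ) (Z : Set (Fin 2 → ℤ → ℝ)) (w : ℤ → ℝ) (r ρ θ₀ θ c₀ c : ℝ) (env₀ : ℤ → ℝ),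
      X₀ 0 ≠ 0 ∧
        GapData₂On shiftSetFlat σ (1 / 4) (0 : Fin 2) (mirrorTable (1 / 2) (1 / 2)) X₀ Z w r ρ θ₀ θ c₀ c env₀ ∧
          TailThin (1 / 4) w r ∧
            ∃ (Cw b : ℝ), 1 ≤ Cw ∧ 1 / 2 ≤ b ∧ ∀ k : ℤ, 0 ≤ k → w k = Cw * (2 : ℝ) ^ ((k : ℝ) ^ 2 / 2 + b * k) := by
  -- the specialisation
  exact stub_rung_quarter_of_certificateL (Kb := 36) (Ka := 12) (hKb := by norm_num) (hKa := by norm_num) (x0q := x0E3) (hx0 := by simp [x0E3])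
    (M := fun k => (Mq k : ℝ)) (w := fun k => ((pgaussW 1 k : ℚ) : ℝ)) (Mq := Mq) (wq := pgaussW 1) (hM := fun _ => rfl) (hwq := fun _ => rfl)
    (r := ((1 / 1000000 : ℚ) : ℝ)) (ρ := ((1 / 2 : ℚ) : ℝ)) (θ₀ := ((3 : ℕ) : ℝ) / ((10 : ℕ) : ℝ)) (θ := 1 / 2) (c₀ := ((9 / 10 : ℚ) : ℝ))
    (c := ((91 / 100 : ℚ) : ℝ)) (σ := ((1 / 4 : ℚ) : ℝ)) (rq := 1 / 1000000) (ρq := 1 / 2) (c₀q := 9 / 10) (cq := 91 / 100) (σq := 1 / 4)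
    (θn := 3) (θd := 10) (hrq := rfl) (hρq := rfl) (hθ₀q := rfl) (hc₀q := rfl) (hcq := rfl) (hσq := rfl)
    (hr := by norm_num) (hρ := by norm_num) (hρ1 := by norm_num) (hθ₀ := by norm_num) (hθ₀θ := by norm_num) (hθ := by norm_num)
    (hc₀ := by norm_num) (hc₀c := by norm_num) (hσ := by norm_num)
    (Mmax := 404) (hMmax := fun k hk1 hk2 => by exact_mod_cast hMmax k hk1 hk2)
    (Cw := 1) (b := 1 / 2) (hCw := le_rfl) (hb := le_rfl)
    (hwp := fun k hk => by rw [pgaussW_of_nonneg 1 hk]; push_cast; ring_nf)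
    (hwn := fun k hk => by rw [pgaussW_of_neg 1 hk]; push_cast; ring_nf)
    (Zb := ZbE3) (Zf := ZfE3) (Cb := 7) (γ := 1 / 2) (hCb := by norm_num) (hγ0 := by norm_num) (hγ1 := by norm_num)
    (hZb := fun j => rfl) (hZf := fun j => rfl) (hMZf := E3_hMZf hM36) (checkB₁ := E3_checkB1) (checkB₂ := E3_checkB2)
    (ν := nuE3) (ν₀ := nu0E3) (ν₁ := nu1E3) (ϑ := varthetaE3) (hνKa := by simp [nuE3]) (hνhi := fun K hK => by simp [nuE3, show ¬K ≤ 12 by omega])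
    (hν₀ := by norm_num [nu0E3]) (hν₁ := by norm_num [nu1E3]) (hMν := E3_hMnu hM12)
    (checkA₁ := E3_checkA1) (checkA₂ := E3_checkA2) (checkA₃ := E3_checkA3) (checkA₄ := E3_checkA4) (checkA₅ := E3_checkA5) (checkA₆ := E3_checkA6)
    (Eb := EbE3) (Et := EtE3) (Zx := ZxE3) (hEb := E3_hEb) (hEt := E3_hEt) (hZx := E3_hZx)
    (hω := hω) (hcoef := hcoef) (hg := hg) (hs := hs) (htr := htr) (hcN := hcN) (hj := hj) (hjN := hjN) (hsec := hsec) (hread := hread)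
    (hbefore := hbefore) (hafter := hafter) (hpos := hpos) (hc₀N := hc₀N) (hid := hid) (hE := hE) (hrefs := hrefs) (hdat := hdat)

end CertificateGlueOn

end Summit.NavierStokesRegularity.NavierStokesRegularity.Theorems

end
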